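import Summits.CriticalPhenomena.PercolationContinuityZ3.Theorems.PercNearOneGluingNoHeavyLowerTailFrontierDecRowsRow15NoCutVertex
import Summits.CriticalPhenomena.PercolationContinuityZ3.Theorems.PercNearOneGluingNoHeavyLowerTailFrontierDecRowsRow15CutVertexAB
import Summits.CriticalPhenomena.PercolationContinuityZ3.Theorems.PercNearOneGluingNoHeavyLowerTailFrontierDecRowsRow15CutVertexAC
import Summits.CriticalPhenomena.PercolationContinuityZ3.Theorems.PercNearOneGluingNoHeavyLowerTailFrontierDecRowsRow15CutVertexAY
import Summits.CriticalPhenomena.PercolationContinuityZ3.Theorems.PercNearOneGluingNoHeavyLowerTailFrontierDecRowsRow37NoCutVertexRow15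
import HarnessLib

/-!
# Frontier dec row 15 reduces to cut-free weighted graphs — UNCONDITIONALLY (route `PercNearOneGluingNoHeavy`, supports-only; prim-l12-p6 g16)

`frontier_15_all_of_noCut` (`…Row15NoCutVertex`) reduced row 15 `E₃(D[ab|c], D[ac|y], D[b|y]) ≥ 0` to weights admitting no cut colouring,
given its three `2|2` cut cases as hypotheses.  Those are now kernel theorems (`sahiE3_row15_nonneg_of_cutVertexAB/AC/AY`, exact certificates
over Harris + 3PT-LB on the two three-point sides, `…Row15CutVertexAB/AC/AY`), so:
THEOREM (`frontier_15_all_of_noCut'`): if row 15 holds for every weight admitting NO cut colouring, it holds on every finite weighted graph —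
exactly as rows 44 (`frontier_44_all_of_noCut`) and 36 (`frontier_36_all_of_noCut`); row 37 follows modulo row 15
(`frontier_37_all_of_row15_of_noCut`, `…Row37NoCutVertexRow15`; combined: `frontier_15_37_all_of_noCut`).  A vertex-minimal counterexample to any of the four open rows of the
four-point decreasing cubic frontier (15, 36, 37 given 15, 44) is therefore 2-connected.
Memo `run/shared/lean/prim/prim-l12/FROM-prim-l12-p6-g16-ROW37-HUB-IDENTITY.md` §4–5.  No definitions, no named facts, no sorries.
-/

noncomputable section

namespace Summit.CriticalPhenomena.PercolationContinuityZ3.Theorems.FrontierDecRows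

open MeasureTheory CovTransferCert E3GroupSepCert
open Literature.Probability.Percolation Literature.Probability.LatticeModels

/-- **Row 15 reduces to cut-free weighted graphs.**  If `E₃(D[ab|c], D[ac|y], D[b|y]) ≥ 0` at every placement on every finite weighted graph whose
weight admits no cut colouring, then it holds at every placement on every finite weighted graph. [this work] -/
theorem frontier_15_all_of_noCut'
    (H : ∀ (n : ℕ) (w : Sym2 (Fin n) → unitInterval) (a b c y : Fin n),
      (∀ (h : Fin n) (side : Fin n → Bool), (∀ u v : Fin n, u ≠ h → v ≠ h → side u ≠ side v → w s(u, v) = 0) →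
        (∃ u v : Fin n, u ≠ h ∧ side u = true ∧ 0 < (w s(u, v) : ℝ)) →
        (∃ u v : Fin n, u ≠ h ∧ side u = false ∧ 0 < (w s(u, v) : ℝ)) → False) →
      0 ≤ sahiE3 (prodBernoulli w) (connEvent (row 15 n (a, b, c, y)).1) (connEvent (row 15 n (a, b, c, y)).2.1)
        (connEvent (row 15 n (a, b, c, y)).2.2))
    (n : ℕ) (w : Sym2 (Fin n) → unitInterval) (a b c y : Fin n) :
    0 ≤ sahiE3 (prodBernoulli w) (connEvent (row 15 n (a, b, c, y)).1) (connEvent (row 15 n (a, b, c, y)).2.1)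
      (connEvent (row 15 n (a, b, c, y)).2.2) :=
  frontier_15_all_of_noCut
    (fun _ w a b c y h side ha hb hc hy hw => sahiE3_row15_nonneg_of_cutVertexAB w a b c y h side ha hb hc hy hw)
    (fun _ w a b c y h side ha hc hb hy hw => sahiE3_row15_nonneg_of_cutVertexAC w a b c y h side ha hc hb hy hw)
    (fun _ w a b c y h side ha hy hb hc hw => sahiE3_row15_nonneg_of_cutVertexAY w a b c y h side ha hy hb hc hw) H n w a b c y

/-- **Rows 15 and 37 together reduce to cut-free weighted graphs.**  If row 15 and row 37 each hold for every weight admitting no cut colouring,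
then both hold on every finite weighted graph (row 15 by `frontier_15_all_of_noCut'`, then row 37 by `frontier_37_all_of_row15_of_noCut`). [this work] -/
theorem frontier_15_37_all_of_noCut
    (H15 : ∀ (n : ℕ) (w : Sym2 (Fin n) → unitInterval) (a b c y : Fin n),
      (∀ (h : Fin n) (side : Fin n → Bool), (∀ u v : Fin n, u ≠ h → v ≠ h → side u ≠ side v → w s(u, v) = 0) →
        (∃ u v : Fin n, u ≠ h ∧ side u = true ∧ 0 < (w s(u, v) : ℝ)) →
        (∃ u v : Fin n, u ≠ h ∧ side u = false ∧ 0 < (w s(u, v) : ℝ)) → False) →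
      0 ≤ sahiE3 (prodBernoulli w) (connEvent (row 15 n (a, b, c, y)).1) (connEvent (row 15 n (a, b, c, y)).2.1)
        (connEvent (row 15 n (a, b, c, y)).2.2))
    (H37 : ∀ (n : ℕ) (w : Sym2 (Fin n) → unitInterval) (a b c y : Fin n),
      (∀ (h : Fin n) (side : Fin n → Bool), (∀ u v : Fin n, u ≠ h → v ≠ h → side u ≠ side v → w s(u, v) = 0) →
        (∃ u v : Fin n, u ≠ h ∧ side u = true ∧ 0 < (w s(u, v) : ℝ)) →
        (∃ u v : Fin n, u ≠ h ∧ side u = false ∧ 0 < (w s(u, v) : ℝ)) → False) →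
      0 ≤ sahiE3 (prodBernoulli w) (connEvent (row 37 n (a, b, c, y)).1) (connEvent (row 37 n (a, b, c, y)).2.1)
        (connEvent (row 37 n (a, b, c, y)).2.2))
    (n : ℕ) (w : Sym2 (Fin n) → unitInterval) (a b c y : Fin n) :
    0 ≤ sahiE3 (prodBernoulli w) (connEvent (row 15 n (a, b, c, y)).1) (connEvent (row 15 n (a, b, c, y)).2.1)
        (connEvent (row 15 n (a, b, c, y)).2.2) ∧
      0 ≤ sahiE3 (prodBernoulli w) (connEvent (row 37 n (a, b, c, y)).1) (connEvent (row 37 n (a, b, c, y)).2.1)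
        (connEvent (row 37 n (a, b, c, y)).2.2) :=
  ⟨frontier_15_all_of_noCut' H15 n w a b c y, frontier_37_all_of_row15_of_noCut (frontier_15_all_of_noCut' H15) H37 n w a b c y⟩

end Summit.CriticalPhenomena.PercolationContinuityZ3.Theorems.FrontierDecRows

end
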